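import Literature.Probability.LatticeModels.RandomClusterFreePercolationProbability
import Literature.Probability.LatticeModels.PlanarIsingCriticalMagnetization
import Literature.Probability.LatticeModels.CriticalFKIsingConnectionLawsBox
import HarnessLib

/-!
# Free Edwards–Sokal in infinite volume, load-bearing direction: `M̃_LRO(β)² ≤ θ⁰(1 - e^{-2β}, 2)`

fk-continuity build cell, row FO-03a (`--supports stmt-CriticalPhenomena-4575`, helper); builds on p205010
(kernel theorem, internal audit signed; external expert review pending). Sorry-free, standard axioms, no
named facts, no new definitions.

For the nearest-neighbour Ising model on `ℤ^d` at inverse temperature `β ≥ 0` and the FK–Ising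
random-cluster model at `p = 1 - e^{-2β}`, `q = 2` with FREE boundary conditions (Grimmett 2006,
Thm. (4.91)(a)/(b) and Thm. (5.17): `π⁰_{β} ↔ φ⁰_{p,2}`, `τ⁰(x,y) = φ⁰_{p,q}(x ↔ y)`; the free half of
eq. (5.18)–(5.19)), this file proves, with finite-volume tools only:

* `FK.isingTwoPoint_free_box_eq_rcMeasure_real_openConn` — the Edwards–Sokal identity on a box of `ℤ^d`:
  `⟨σ_xσ_y⟩^∅_{Λ_N;β,0} = φ⁰_{Λ_N,p,2}(x ↔ y)` (the tree's `edwardsSokal_twoPoint_holds`, Grimmett 2006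
  Thm. (1.16), transported from the finite graph `(Λ_N, E_{Λ_N})` to the box of `ℤ^d` by
  `isingTwoPoint_free_map`);
* `FK.finsetRestrict_mem_originToBoundary_of_reachable` — the event inclusion `{0 ↔ z} ⊆ {0 ↔ ∂Λ_n}`
  on a box for `z ∉ Λ_n` (an open path leaving `Λ_n` passes `∂Λ_n`; the tree's
  `exists_reachable_wiredBoundary_restrict_of_notMem`, Grimmett 2006, proof of Prop. (5.11));
* `FK.twoPointFree_le_thetaFreeArm`, `FK.freePair_le_thetaFreeArm` — **`⟨σ_xσ_y⟩^∅_{β,0} ≤ φ⁰_{p,2}(0 ↔ ∂Λ_n)`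
  whenever `y - x ∉ Λ_n`**: in the box `Λ_N`, `⟨σ_0σ_z⟩^∅_{Λ_N} = φ⁰_{Λ_N}(0 ↔ z) ≤ φ⁰_{Λ_N}(0 ↔ ∂Λ_n) =
  thetaFreeBox n (N - n) ≤ thetaFreeArm n` (the free box measures increase with the box, Grimmett 2006
  Thm. (4.19)(a) eq. (4.24), already inside `thetaFreeBox_le_thetaFreeArm`), then `N → ∞`
  (`hasBoxLimit_isingCorr_free_holds`) and translation invariance of the free pair correlation
  (`freePair_eq_twoPointFree_sub`);
* `FK.freeBlockAverage_box_le` — the Cesàro step (ADS15 §1.3, (1.9)–(1.10)):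
  `|Λ_N|⁻² ∑_{x,y ∈ Λ_N} ⟨σ_xσ_y⟩^∅ ≤ |Λ_n| / |Λ_N| + φ⁰_{p,2}(0 ↔ ∂Λ_n)`;
* `FK.lroTildeSq_le_thetaFreeArm`, **`FK.lroTildeSq_le_thetaFree`** — `M̃_LRO(β)² ≤ φ⁰_{p,2}(0 ↔ ∂Λ_n)` for
  every `n`, hence **`M̃_LRO(β)² ≤ θ⁰(1 - e^{-2β}, 2)`** (`d ≥ 1`, `β ≥ 0`);
* **`FK.lroTildeSq_eq_zero_of_thetaFree_eq_zero`** — the load-bearing direction of Grimmett's (5.18) at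
  `q = 2`: if the FREE FK–Ising model does not percolate, `θ⁰(p,2) = 0`, then ADS15's variant long-range
  order parameter vanishes, `M̃_LRO(β) = 0` (the hypothesis of ADS15 Thm. 1.2 / Thm. 3.1);
* `FK.twoPointFree_tendsto_zero_of_thetaFree_eq_zero` — likewise `⟨σ_0σ_x⟩^∅_β → 0` as `x → ∞`.

The converse direction of (5.18) (`M̃_LRO = 0 ⇒ θ⁰ = 0`, which needs the infinite-volume free
measure, FKG and uniqueness of the infinite cluster) is row FO-03b and is NOT here. Nothing here uses
reflection positivity, the infrared bound, or any critical-point input: the nonnegativity of the block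
averages is re-derived from `freePair_nonneg` (first Griffiths inequality) and not taken from
`LroInfraredBound.lean`.

## References

* G. Grimmett, *The Random-Cluster Model*, Springer 2006: Thm. (1.16); §4.2 (4.11)–(4.12);
  Thm. (4.19)(a), eq. (4.24); §4.6 Thm. (4.91); §5.1 (5.1), Prop. (5.11); Thm. (5.17), eqs.
  (5.18)–(5.19). [Grimmett2006]
* M. Aizenman, H. Duminil-Copin, V. Sidoravicius, Comm. Math. Phys. 334 (2015) 719–742, §1.3
  eqs. (1.9)–(1.10). [AizenmanDuminilCopinSidoraviciusCMP2015]
* R. G. Edwards, A. D. Sokal, Phys. Rev. D 38 (1988) 2009–2012. [EdwardsSokal1988]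
-/

noncomputable section

namespace Summit.CriticalPhenomena.PercolationContinuityZ3.Theorems

namespace FK

open MeasureTheory Finset SimpleGraph Filter Topology
open Literature.Probability.LatticeModels Literature.Barriers.CriticalPhenomena
open Literature.Probability.Percolation

variable {d : ℕ}

/-! ### Edwards–Sokal on a box of `ℤ^d`, and the event inclusion `{0 ↔ z} ⊆ {0 ↔ ∂Λ_n}` -/

/-- **Edwards–Sokal on the box `Λ_N` of `ℤ^d`** (Grimmett 2006, Thm. (1.16), `q = 2`, free boundary
condition): for `β ≥ 0`, `p = 1 - e^{-2β}` and `x, y ∈ Λ_N`,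
`⟨σ_xσ_y⟩^∅_{Λ_N;β,0} = φ⁰_{Λ_N,p,2}(x ↔ y)`, the right side being the free random-cluster measure of
the finite graph `(Λ_N, E_{Λ_N})`. The tree's `edwardsSokal_twoPoint_holds` on that finite graph,
transported to the box of `ℤ^d` by `isingTwoPoint_free_map` (spins outside `Λ_N` do not interact
under the free boundary condition). [cite: Grimmett2006, Thm. (1.16)] [cite: EdwardsSokal1988] -/
theorem isingTwoPoint_free_box_eq_rcMeasure_real_openConn {β : ℝ} (hβ : 0 ≤ β) {N : ℕ}
    {x y : Site d} (hx : x ∈ box d N) (hy : y ∈ box d N) :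
    isingTwoPoint (zdGraph d) (box d N) β 0 .free x y =
      (rcMeasure (finsetGraph (zdGraph d) (box d N)) (fkIsingParam β) 2 ∅).real
        (openConn (⟨x, hx⟩ : ↥(box d N)) ⟨y, hy⟩) := by
  classical
  set GΛ : SimpleGraph ↥(box d N) := finsetGraph (zdGraph d) (box d N) with hGΛ
  set x' : ↥(box d N) := ⟨x, hx⟩ with hx'
  set y' : ↥(box d N) := ⟨y, hy⟩ with hy'
  -- the free two-point Edwards–Sokal identity on the finite graph `(Λ_N, E_{Λ_N})`
  have h2 : (rcMeasure GΛ (fkIsingParam β) 2 ∅).real (openConn x' y') =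
      isingTwoPoint GΛ univ β 0 .free x' y' :=
    (edwardsSokal_twoPoint_holds GΛ hβ x' y').symm
  -- transported to the box of `ℤ^d`
  set ι : ↥(box d N) ↪ Site d := Function.Embedding.subtype (· ∈ box d N) with hι
  have hmap : (univ : Finset ↥(box d N)).map ι = box d N := by
    rw [hι, Finset.univ_eq_attach, Finset.attach_map_val]
  have hadjι : ∀ a ∈ (univ : Finset ↥(box d N)), ∀ b ∈ (univ : Finset ↥(box d N)),
      ((zdGraph d).Adj (ι a) (ι b) ↔ GΛ.Adj a b) := fun _ _ _ _ => Iff.rfl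
  have h3 : isingTwoPoint GΛ univ β 0 .free x' y' =
      isingTwoPoint (zdGraph d) (box d N) β 0 .free x y := by
    have h := isingTwoPoint_free_map (G := GΛ) (G' := zdGraph d) ι (Λ := univ) hadjι β 0 x' y'
    rw [hmap] at h
    exact h.symm
  rw [← h3, ← h2]

/-- **`{0 ↔ z} ⊆ {0 ↔ ∂Λ_n}` on the box `Λ_N`** (`n ≤ N`, `z ∈ Λ_N ∖ Λ_n`): if the origin is joined to
`z` by an open path of a configuration `ω ⊆ E_{Λ_N}`, then in the restriction of `ω` to `E_{Λ_n}` the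
origin is joined to `∂Λ_n` (the tree's event `originToBoundary d n`; by the tree's path lemma
`exists_reachable_wiredBoundary_restrict_of_notMem`: an open path leaving `Λ_n` passes `∂Λ_n`).
[cite: Grimmett2006, Prop. (5.11) (proof) and Thm. (5.17), proof of (5.18), p. 107] -/
theorem finsetRestrict_mem_originToBoundary_of_reachable {n N : ℕ} (hnN : n ≤ N) {z : Site d}
    (hzN : z ∈ box d N) (hzn : z ∉ box d n) {ω : BondConfig ↥(box d N)}
    (hω : ω ⊆ (finsetGraph (zdGraph d) (box d N)).edgeSet)
    (hreach : (openGraph ω).Reachable (⟨0, zero_mem_box d N⟩ : ↥(box d N)) ⟨z, hzN⟩) :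
    finsetRestrict (box_mono d hnN) ω ∈ originToBoundary d n := by
  obtain ⟨w, hw, hxw⟩ := exists_reachable_wiredBoundary_restrict_of_notMem (box_mono d hnN) hω
    (x := boxOrigin d n) (y := ⟨z, hzN⟩) hzn hreach
  exact ⟨w, hw, hxw⟩

/-- **`⟨σ_0σ_z⟩^∅_{Λ_N;β,0} ≤ φ⁰_{Λ_N,p,2}(0 ↔ ∂Λ_n) = thetaFreeBox n (N - n)`** for `n ≤ N` and
`z ∈ Λ_N ∖ Λ_n` (`β ≥ 0`, `p = 1 - e^{-2β}`): Edwards–Sokal on the box and the event inclusion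
`{0 ↔ z} ⊆ {0 ↔ ∂Λ_n}`. [cite: Grimmett2006, Thm. (5.17) (proof: τ⁰(x,y) ≤ φ⁰(x ↔ ∂Λ)) with Thm. (1.16)] -/
theorem isingTwoPoint_free_box_le_thetaFreeBox {β : ℝ} (hβ : 0 ≤ β) {n N : ℕ} (hnN : n ≤ N)
    {z : Site d} (hzN : z ∈ box d N) (hzn : z ∉ box d n) :
    isingTwoPoint (zdGraph d) (box d N) β 0 .free 0 z ≤ thetaFreeBox d (fkIsingParam β) 2 n (N - n) := by
  rw [isingTwoPoint_free_box_eq_rcMeasure_real_openConn hβ (zero_mem_box d N) hzN, thetaFreeBox_eq,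
    boxFreeReal_sub_eq hnN]
  exact rcMeasure_real_mono_on_edgeSets _ (fkIsingParam_mem_Icc hβ) two_pos ∅
    fun ω hω hmem => finsetRestrict_mem_originToBoundary_of_reachable hnN hzN hzn hω hmem

/-! ### `⟨σ_xσ_y⟩^∅_β ≤ φ⁰_{p,2}(0 ↔ ∂Λ_n)` off the box `x + Λ_n` -/

/-- The free two-point function is the box limit of the finite-volume free two-point functions,
`⟨σ_0σ_z⟩^∅_{Λ_N;β,0} → ⟨σ_0σ_z⟩^∅_{β,0}` (`β ≥ 0`; Friedli–Velenik 2017, Exercise 3.16, by GKS — the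
tree's `hasBoxLimit_isingCorr_free_holds`). [cite: FriedliVelenik2017, Exercise 3.16] -/
theorem tendsto_isingTwoPoint_free_box {β : ℝ} (hβ : 0 ≤ β) (z : Site d) :
    Tendsto (fun N : ℕ => isingTwoPoint (zdGraph d) (box d N) β 0 .free 0 z) atTop
      (𝓝 (twoPointFree d β z)) := by
  classical
  rcases eq_or_ne (0 : Site d) z with rfl | h0z
  · simp only [isingTwoPoint_self, twoPointFree_zero]
    exact tendsto_const_nhds
  have h : Tendsto (fun N : ℕ => isingCorr (zdGraph d) (box d N) β 0 .free {0, z}) atTop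
      (𝓝 (freeCorr d β 0 {0, z})) :=
    hasBoxLimit_isingCorr_free_holds (d := d) hβ le_rfl ({0, z} : Finset (Site d))
  have e1 : twoPointFree d β z = freeCorr d β 0 {0, z} := by
    simp only [twoPointFree, freeCorr, freeExpect, spinPair_eq_spinProduct h0z]
  have e2 : ∀ N : ℕ, isingTwoPoint (zdGraph d) (box d N) β 0 .free 0 z =
      isingCorr (zdGraph d) (box d N) β 0 .free {0, z} := fun N => by
    simp only [isingTwoPoint, isingCorr, spinPair_eq_spinProduct h0z]
  rw [e1]
  exact h.congr fun N => (e2 N).symm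

/-- **`⟨σ_0σ_z⟩^∅_{β,0} ≤ φ⁰_{p,2}(0 ↔ ∂Λ_n)` for `z ∉ Λ_n`** (`β ≥ 0`, `p = 1 - e^{-2β}`): in every
large box `⟨σ_0σ_z⟩^∅_{Λ_N} ≤ φ⁰_{Λ_N,p,2}(0 ↔ ∂Λ_n) ≤ sup_k φ⁰_{Λ_{n+k},p,2}(0 ↔ ∂Λ_n) = thetaFreeArm n`
(the free box measures increase with the box, Grimmett 2006 Thm. (4.19)(a), (4.24)), and
`N → ∞` on the left. This is the finite-volume content of `τ⁰(0,z) ≤ φ⁰_{p,q}(0 ↔ ∂Λ_n)`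
(Grimmett 2006, Thm. (5.17) with (4.91)). [cite: Grimmett2006, Thm. (5.17), eq. (5.18), with Thm. (4.19)(a) eq. (4.24)] -/
theorem twoPointFree_le_thetaFreeArm {β : ℝ} (hβ : 0 ≤ β) {n : ℕ} {z : Site d}
    (hzn : z ∉ box d n) : twoPointFree d β z ≤ thetaFreeArm d (fkIsingParam β) 2 n := by
  have hp : fkIsingParam β ∈ Set.Icc (0 : ℝ) 1 := fkIsingParam_mem_Icc hβ
  refine le_of_tendsto (tendsto_isingTwoPoint_free_box hβ z) ?_
  filter_upwards [eventually_ge_atTop (max n (siteRad z))] with N hN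
  have hnN : n ≤ N := le_of_max_le_left hN
  have hzN : z ∈ box d N := mem_box_iff_siteRad_le.2 (le_of_max_le_right hN)
  exact (isingTwoPoint_free_box_le_thetaFreeBox hβ hnN hzN hzn).trans
    (thetaFreeBox_le_thetaFreeArm hp two_pos n _)

/-- **`⟨σ_xσ_y⟩^∅_{β,0} ≤ φ⁰_{p,2}(0 ↔ ∂Λ_n)` whenever `y - x ∉ Λ_n`** (`β ≥ 0`, `p = 1 - e^{-2β}`), by
translation invariance of the free pair correlation (`freePair_eq_twoPointFree_sub`).
[cite: Grimmett2006, Thm. (5.17), eq. (5.18), p. 102 (proof p. 107)] [cite: FriedliVelenik2017, Exercise 3.16] -/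
theorem freePair_le_thetaFreeArm {β : ℝ} (hβ : 0 ≤ β) {n : ℕ} {x y : Site d}
    (hxy : y - x ∉ box d n) : freePair d β x y ≤ thetaFreeArm d (fkIsingParam β) 2 n := by
  rw [freePair_eq_twoPointFree_sub hβ]
  exact twoPointFree_le_thetaFreeArm hβ hxy

/-- `⟨σ_xσ_y⟩^∅_{β,0} ≤ 1` (`β ≥ 0`). [cite: FriedliVelenik2017, §3.7.4] -/
theorem freePair_le_one {β : ℝ} (hβ : 0 ≤ β) (x y : Site d) : freePair d β x y ≤ 1 := by
  rw [freePair_eq_twoPointFree_sub hβ]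
  exact twoPointFree_le_one' hβ _

/-! ### The Cesàro step: block averages and `M̃_LRO(β)²` -/

/-- Block averages of the free pair correlation are nonnegative (first Griffiths inequality,
`freePair_nonneg`; re-derived here so that no constant of `LroInfraredBound.lean` enters the cone).
[cite: AizenmanDuminilCopinSidoraviciusCMP2015, §1.3] -/
theorem freeBlockAverage_nonneg_of_nonneg_beta {β : ℝ} (hβ : 0 ≤ β) (B : Finset (Site d)) :
    0 ≤ freeBlockAverage d β B := by
  rw [freeBlockAverage_def]
  exact div_nonneg (sum_nonneg fun x _ => sum_nonneg fun y _ => freePair_nonneg hβ x y)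
    (pow_nonneg (Nat.cast_nonneg _) 2)

/-- The defining set of `M̃_LRO(β)²` is bounded below by `0` (`β ≥ 0`), so `M̃_LRO(β)²` is at most
every block average (`lroTildeSq_le`). [cite: AizenmanDuminilCopinSidoraviciusCMP2015, §1.3, eq. (1.9)] -/
theorem bddBelow_freeBlockAverage_image {β : ℝ} (hβ : 0 ≤ β) :
    BddBelow (freeBlockAverage d β '' {B : Finset (Site d) | B.Nonempty}) :=
  ⟨0, by rintro _ ⟨B, -, rfl⟩; exact freeBlockAverage_nonneg_of_nonneg_beta hβ B⟩

/-- `0 ≤ M̃_LRO(β)²` for `β ≥ 0` (first Griffiths inequality).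
[cite: AizenmanDuminilCopinSidoraviciusCMP2015, §1.3, eq. (1.9)] -/
theorem lroTildeSq_nonneg {β : ℝ} (hβ : 0 ≤ β) : 0 ≤ lroTildeSq d β :=
  le_lroTildeSq d fun B _ => freeBlockAverage_nonneg_of_nonneg_beta hβ B

/-- **The Cesàro step** (ADS15 §1.3, eqs. (1.9)–(1.10), with Grimmett's (5.18) as the pointwise
input): for `β ≥ 0`, `p = 1 - e^{-2β}` and all `n, N`,
`|Λ_N|⁻² ∑_{x,y ∈ Λ_N} ⟨σ_xσ_y⟩^∅_β ≤ |Λ_n| / |Λ_N| + φ⁰_{p,2}(0 ↔ ∂Λ_n)`: pairs with `y - x ∈ Λ_n`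
(at most `|Λ_n|` values of `y` for each `x`) contribute at most `1` each, the others at most
`φ⁰_{p,2}(0 ↔ ∂Λ_n)` (`freePair_le_thetaFreeArm`).
[cite: AizenmanDuminilCopinSidoraviciusCMP2015, §1.3, eqs. (1.9)–(1.10)] -/
theorem freeBlockAverage_box_le {β : ℝ} (hβ : 0 ≤ β) (n N : ℕ) :
    freeBlockAverage d β (box d N) ≤
      #(box d n) / #(box d N) + thetaFreeArm d (fkIsingParam β) 2 n := by
  classical
  set t : ℝ := thetaFreeArm d (fkIsingParam β) 2 n with ht
  have ht0 : 0 ≤ t := thetaFreeArm_nonneg _ _ n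
  have hBpos : (0 : ℝ) < #(box d N) := by exact_mod_cast (box_nonempty d N).card_pos
  -- the inner sums: `∑_{y ∈ Λ_N} ⟨σ_xσ_y⟩^∅ ≤ |Λ_n| + t |Λ_N|`
  have hinner : ∀ x ∈ box d N, ∑ y ∈ box d N, freePair d β x y ≤ #(box d n) + t * #(box d N) := by
    intro x _
    have hpt : ∀ y ∈ box d N, freePair d β x y ≤ (if y - x ∈ box d n then (1 : ℝ) else 0) + t := by
      intro y _
      split_ifs with hyx
      · linarith [freePair_le_one hβ x y]
      · rw [zero_add]; exact freePair_le_thetaFreeArm hβ hyx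
    refine (sum_le_sum hpt).trans ?_
    rw [sum_add_distrib, sum_boole, sum_const, nsmul_eq_mul]
    have hcard : #((box d N).filter fun y => y - x ∈ box d n) ≤ #(box d n) := by
      refine card_le_card_of_injOn (fun y => y - x) (fun y hy => ?_) fun y₁ _ y₂ _ h12 => ?_
      · exact (Finset.mem_filter.1 hy).2
      · simpa using h12
    have hcard' : (#((box d N).filter fun y => y - x ∈ box d n) : ℝ) ≤ #(box d n) := by
      exact_mod_cast hcard
    linarith [hcard', mul_comm (#(box d N) : ℝ) t]
  have hsum : ∑ x ∈ box d N, ∑ y ∈ box d N, freePair d β x y ≤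
      #(box d N) * (#(box d n) + t * #(box d N)) := by
    calc ∑ x ∈ box d N, ∑ y ∈ box d N, freePair d β x y
        ≤ ∑ x ∈ box d N, ((#(box d n) : ℝ) + t * #(box d N)) := sum_le_sum hinner
      _ = #(box d N) * (#(box d n) + t * #(box d N)) := by rw [sum_const, nsmul_eq_mul]
  have hB : (#(box d N) : ℝ) ≠ 0 := hBpos.ne'
  rw [freeBlockAverage_def]
  calc (∑ x ∈ box d N, ∑ y ∈ box d N, freePair d β x y) / (#(box d N) : ℝ) ^ 2
      ≤ #(box d N) * (#(box d n) + t * #(box d N)) / (#(box d N) : ℝ) ^ 2 :=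
        div_le_div_of_nonneg_right hsum (pow_nonneg hBpos.le 2)
    _ = #(box d n) / #(box d N) + t := by
        rw [pow_two, mul_div_mul_left _ _ hB, add_div, mul_div_cancel_right₀ t hB]

/-- **`M̃_LRO(β)² ≤ φ⁰_{p,2}(0 ↔ ∂Λ_n)` for every `n`** (`d ≥ 1`, `β ≥ 0`, `p = 1 - e^{-2β}`):
`M̃_LRO(β)² ≤` the block average over `Λ_N` (`lroTildeSq_le`) `≤ |Λ_n|/|Λ_N| + φ⁰_{p,2}(0 ↔ ∂Λ_n)`, and
`|Λ_N| ≥ N → ∞` (`d ≥ 1`; for `d = 0` the lattice is one point and `M̃_LRO = 1`).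
[cite: AizenmanDuminilCopinSidoraviciusCMP2015, §1.3, eqs. (1.9)–(1.10)] [cite: Grimmett2006, Thm. (5.17), eq. (5.18), p. 102 (proof p. 107)] -/
theorem lroTildeSq_le_thetaFreeArm (hd : 1 ≤ d) {β : ℝ} (hβ : 0 ≤ β) (n : ℕ) :
    lroTildeSq d β ≤ thetaFreeArm d (fkIsingParam β) 2 n := by
  refine le_of_forall_pos_le_add fun ε hε => ?_
  -- a box `Λ_N` with `|Λ_n| ≤ ε |Λ_N|`
  obtain ⟨N, hN⟩ : ∃ N : ℕ, (#(box d n) : ℝ) ≤ ε * N := by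
    obtain ⟨N, hN⟩ := exists_nat_ge ((#(box d n) : ℝ) / ε)
    exact ⟨N, by rwa [div_le_iff₀' hε] at hN⟩
  have hcardB : (N : ℝ) ≤ #(box d N) := by
    have h1 : N ≤ #(box d N) := by
      rw [card_box]
      calc N ≤ 2 * N + 1 := by omega
        _ = (2 * N + 1) ^ 1 := (pow_one _).symm
        _ ≤ (2 * N + 1) ^ d := Nat.pow_le_pow_right (by omega) hd
    exact_mod_cast h1
  have hBpos : (0 : ℝ) < #(box d N) := by exact_mod_cast (box_nonempty d N).card_pos
  have hratio : (#(box d n) : ℝ) / #(box d N) ≤ ε := by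
    rw [div_le_iff₀ hBpos]
    exact hN.trans (mul_le_mul_of_nonneg_left hcardB hε.le)
  calc lroTildeSq d β ≤ freeBlockAverage d β (box d N) :=
        lroTildeSq_le d (bddBelow_freeBlockAverage_image hβ) (box_nonempty d N)
    _ ≤ #(box d n) / #(box d N) + thetaFreeArm d (fkIsingParam β) 2 n := freeBlockAverage_box_le hβ n N
    _ ≤ thetaFreeArm d (fkIsingParam β) 2 n + ε := by linarith

/-- **`M̃_LRO(β)² ≤ θ⁰(1 - e^{-2β}, 2)`** on `ℤ^d`, `d ≥ 1`, `β ≥ 0`: ADS15's variant long-range order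
parameter of the free Ising state is dominated by the FREE FK–Ising percolation probability
`θ⁰(p,2) = inf_n φ⁰_{p,2}(0 ↔ ∂Λ_n)` (`thetaFree`). The free, finite-volume half of Grimmett 2006
Thm. (5.17) eq. (5.18) (`(1 - q⁻¹) θ⁰(p,q)² = lim τ⁰(0,u) - q⁻¹`) combined with the Cesàro bound
`M̃_LRO² ≤ limsup_u ⟨σ_0σ_u⟩^∅` (ADS15 §1.3). [cite: Grimmett2006, Thm. (5.17), eq. (5.18), p. 102 (proof p. 107)] [cite: AizenmanDuminilCopinSidoraviciusCMP2015, §1.3, eqs. (1.9)–(1.10)] -/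
theorem lroTildeSq_le_thetaFree (hd : 1 ≤ d) {β : ℝ} (hβ : 0 ≤ β) :
    lroTildeSq d β ≤ thetaFree d (fkIsingParam β) 2 :=
  le_ciInf fun n => lroTildeSq_le_thetaFreeArm hd hβ n

/-- **FO-03a, the load-bearing direction of the free Edwards–Sokal dictionary in infinite volume**:
on `ℤ^d`, `d ≥ 1`, at `β ≥ 0`, if the FREE FK–Ising random-cluster model at `p = 1 - e^{-2β}` does
not percolate, `θ⁰(p, 2) = 0`, then `M̃_LRO(β)² = 0` — the hypothesis of ADS15 Thm. 1.2 / Thm. 3.1.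
(Grimmett 2006, Thm. (5.17) eq. (5.18) at `q = 2`, '⇒' half; no infinite-volume measure, no
uniqueness, no reflection positivity is used.)
[cite: Grimmett2006, Thm. (5.17), eq. (5.18), p. 102 (proof p. 107)] [cite: AizenmanDuminilCopinSidoraviciusCMP2015, Thm. 1.2 (hypothesis (1.12))] -/
theorem lroTildeSq_eq_zero_of_thetaFree_eq_zero (hd : 1 ≤ d) {β : ℝ} (hβ : 0 ≤ β)
    (h0 : thetaFree d (fkIsingParam β) 2 = 0) : lroTildeSq d β = 0 :=
  le_antisymm (h0 ▸ lroTildeSq_le_thetaFree hd hβ) (lroTildeSq_nonneg hβ)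

/-- **No long-range order in the free Ising state when the free FK–Ising model does not percolate**:
`θ⁰(1 - e^{-2β}, 2) = 0 ⇒ ⟨σ_0σ_x⟩^∅_{β,0} → 0` as `x → ∞` in `ℤ^d` (`β ≥ 0`): outside `Λ_n` the
two-point function is at most `φ⁰_{p,2}(0 ↔ ∂Λ_n) → θ⁰(p,2) = 0`.
[cite: Grimmett2006, Thm. (5.17), eq. (5.18), p. 102 (proof p. 107)] -/
theorem twoPointFree_tendsto_zero_of_thetaFree_eq_zero {β : ℝ} (hβ : 0 ≤ β)
    (h0 : thetaFree d (fkIsingParam β) 2 = 0) : Tendsto (twoPointFree d β) cofinite (𝓝 0) := by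
  have hp : fkIsingParam β ∈ Set.Icc (0 : ℝ) 1 := fkIsingParam_mem_Icc hβ
  have hlim : Tendsto (fun n : ℕ => thetaFreeArm d (fkIsingParam β) 2 n) atTop (𝓝 0) :=
    h0 ▸ tendsto_thetaFreeArm hp two_pos
  rw [Metric.tendsto_nhds]
  intro ε hε
  obtain ⟨n, hn⟩ := (hlim.eventually (gt_mem_nhds hε)).exists
  filter_upwards [(box d n).finite_toSet.compl_mem_cofinite] with z hz
  have hz' : z ∉ box d n := fun h => hz (Finset.mem_coe.2 h)
  rw [Real.dist_eq, sub_zero, abs_of_nonneg (twoPointFree_nonneg' hβ z)]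
  exact (twoPointFree_le_thetaFreeArm hβ hz').trans_lt hn

end FK

end Summit.CriticalPhenomena.PercolationContinuityZ3.Theorems

end
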